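import Summits.Ventures.PercRepro.Night2OneFatSourcesC

/-!
# PercRepro — a source of a one-coloop target is a good point of its erasure (night-2, gen 29)

Let `S ⊆ G` with `coloops (S ∖ K) = {w}` and let `y₀ ∈ S` be a source (`S ∖ y₀` has a lossy big face), so
`Q₀ = (S ∖ y₀) ∖ K` has exactly three coloops, `w` among them.  The thin faces of `S ∖ y₀` are the faces at those coloops;
`y₀` lies in the closure of the face at `w` (the ranks of `(S ∖ K) ∖ w` and `Q₀ ∖ w` are both `4`) and NOT in the closure
of the face at a coloop `a ≠ w` of `Q₀` (`(S ∖ K) ∖ a` has rank `5`, `Q₀ ∖ a` rank `4`).  Hence `y₀` lies in exactly one face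
closure: **a source of a one-coloop target is a good point of its erasure** — its load reaches `S` through the good case
of the rule, never through a fallback (`mem_gtPts_of_source_one_coloop`).

* `mem_clF_face_coloop`, `notMem_clF_face_of_not_coloop` (off `K`), `mem_clF_sdiff_coloops_of_mem_clF_insert` (removing `K`),
  **`mem_gtPts_of_source_one_coloop`**.
-/

namespace PercRepro.Shadow

open Finset PerFlat ThmH

variable {α : Type*} [DecidableEq α] {M : Matroid α} [M.Finite] {G : Finset α}

section CaseOneGeom

/-- `y ∈ cl ((V ∖ y) ∖ u)` for a coloop `u` of `V` (`rk V = 5`, `rk (V ∖ y) = 5`, `y ≠ u`). -/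
theorem mem_clF_face_coloop {V : Finset α} (hVg : V ⊆ gr M) (hV5 : rkN M V = 5) {u : α} (hu : u ∈ coloops M V)
    {y : α} (hy : y ∈ V) (hyu : y ≠ u) (hy5 : rkN M (V.erase y) = 5) : y ∈ clF M ((V.erase y).erase u) := by
  have hu' : u ∈ coloops M (V.erase y) := mem_coloops_erase_of_mem_coloops hu (Ne.symm hyu)
  have h1 : rkN M ((V.erase y).erase u) = 4 := by
    have := rkN_erase_of_mem_coloops (M := M) ((Finset.erase_subset _ _).trans hVg) hu'
    omega
  have h2 : rkN M (V.erase u) = 4 := by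
    have := rkN_erase_of_mem_coloops (M := M) hVg hu
    omega
  exact mem_clF_of_rkN_eq (Finset.erase_subset_erase u (Finset.erase_subset y V))
    ((Finset.erase_subset _ _).trans hVg) (by rw [h1, h2]) (Finset.mem_erase.2 ⟨hyu, hy⟩)

/-- `y ∉ cl ((V ∖ y) ∖ a)` for a coloop `a` of `V ∖ y` that is NOT a coloop of `V` (`rk V = 5 = rk (V ∖ y)`). -/
theorem notMem_clF_face_of_not_coloop {V : Finset α} (hVg : V ⊆ gr M) (hV5 : rkN M V = 5) {y : α} (hy : y ∈ V)
    (hy5 : rkN M (V.erase y) = 5) {a : α} (ha : a ∈ coloops M (V.erase y)) (haV : a ∉ coloops M V) :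
    y ∉ clF M ((V.erase y).erase a) := by
  intro hcl
  have haV' : a ∈ V := (Finset.erase_subset _ _) (mem_coloops.1 ha).1
  have hya : y ≠ a := fun h => (Finset.mem_erase.1 (mem_coloops.1 ha).1).1 h.symm
  have h1 : rkN M ((V.erase y).erase a) = 4 := by
    have := rkN_erase_of_mem_coloops (M := M) ((Finset.erase_subset _ _).trans hVg) ha
    omega
  -- `a` is not a coloop of `V`: `rk (V ∖ a) = 5`
  have h2 : rkN M (V.erase a) = 5 := by
    have hacl : a ∈ clF M (V.erase a) := by
      by_contra hn
      exact haV (mem_coloops.2 ⟨haV', hn⟩)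
    have h3 := rkN_insert_le_of_mem_clF (M := M) ((Finset.erase_subset _ _).trans hVg) hacl
    rw [Finset.insert_erase haV', hV5] at h3
    have h4 : rkN M (V.erase a) ≤ 5 := by rw [← hV5]; exact rkN_mono (Finset.erase_subset _ _)
    omega
  -- adding `y` to `(V ∖ y) ∖ a` gives `V ∖ a`, of rank `5`, while `y ∈ cl` keeps the rank `4`
  have h5 := rkN_insert_le_of_mem_clF (M := M) ((Finset.erase_subset _ _).trans
    ((Finset.erase_subset _ _).trans hVg)) hcl
  have heq : insert y ((V.erase y).erase a) = V.erase a := by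
    rw [Finset.erase_right_comm, Finset.insert_erase (Finset.mem_erase.2 ⟨hya, hy⟩)]
  rw [heq, h2, h1] at h5
  omega

/-- Removing the coloop `e₀` of `G` from a closure: `y ∈ cl (insert e₀ X)` with `X ⊆ G ∖ K`, `y ∈ G ∖ K` gives `y ∈ cl X`. -/
theorem mem_clF_sdiff_coloops_of_mem_clF_insert (hG : G ∈ flatsQ M (5 + 1)) {e₀ : α}
    (he₀ : coloops M G = {e₀}) {X : Finset α} (hX : X ⊆ G \ coloops M G) {y : α} (hy : y ∈ G \ coloops M G)
    (hcl : y ∈ clF M (insert e₀ X)) : y ∈ clF M X := by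
  have hGg : G ⊆ gr M := (mem_flatsQ.1 hG).1
  have he₀c : e₀ ∈ coloops M G := by rw [he₀]; exact Finset.mem_singleton_self _
  have he₀G : e₀ ∈ G := (mem_coloops.1 he₀c).1
  have he₀cl : e₀ ∉ clF M (G.erase e₀) := (mem_coloops.1 he₀c).2
  have hsub : ∀ Z ⊆ G \ coloops M G, Z ⊆ G.erase e₀ := by
    intro Z hZ a ha
    have := hZ ha
    rw [Finset.mem_sdiff] at this
    exact Finset.mem_erase.2 ⟨fun h => this.2 (h ▸ he₀c), this.1⟩
  by_contra hn
  have h1 := rkN_insert_of_notMem_clF (M := M) (hGg (Finset.mem_sdiff.1 hy).1) hn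
  have he₀n : e₀ ∉ clF M (insert y X) :=
    fun h => he₀cl (clF_mono (hsub _ (Finset.insert_subset hy hX)) h)
  have h2 := rkN_insert_of_notMem_clF (M := M) (hGg he₀G) he₀n
  have h3 := rkN_insert_le_of_mem_clF (M := M) (Finset.insert_subset (hGg he₀G)
    (hX.trans (Finset.sdiff_subset.trans hGg))) hcl
  have h4 : rkN M (insert e₀ X) ≤ rkN M X + 1 := by
    by_cases he : e₀ ∈ clF M X
    · have := rkN_insert_le_of_mem_clF (M := M) (hX.trans (Finset.sdiff_subset.trans hGg)) he
      omega
    · have := rkN_insert_of_notMem_clF (M := M) (hGg he₀G) he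
      omega
  rw [Finset.insert_comm] at h2
  rw [h2, h1] at h3
  omega

open scoped Classical in
/-- **A SOURCE OF A ONE-COLOOP TARGET IS A GOOD POINT OF ITS ERASURE** (cell `(2, 1)`). -/
theorem mem_gtPts_of_source_one_coloop (hG : G ∈ flatsQ M (5 + 1)) (hd : (gr M \ G).card = 2)
    (hk : kColoops M G = 1) (hs : ∀ e ∈ gr M, ∀ f ∈ gr M, e ≠ f → rkN M {e, f} = 2)
    (hl : ∀ e ∈ gr M, M.Indep {e}) {S : Finset α} (hSG : S ⊆ G) {w : α}
    (hc : coloops M (S \ coloops M G) = {w}) {y₀ : α} (hy₀ : y₀ ∈ S) {w₀ : α} (hw₀ : w₀ ∈ S.erase y₀)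
    (h0 : faceLossP M 5 G (bigP M G) (S.erase y₀) w₀ ≠ 0) : y₀ ∈ gtPts M 5 G (S.erase y₀) := by
  have hd' : (gr M \ G).card ≤ 5 := by omega
  have hGg : G ⊆ gr M := (mem_flatsQ.1 hG).1
  obtain ⟨hQG, hQ5, hC3, hImg, -, -⟩ := lossy_structure_of_faceLossP_ne_zero hG hd hk hs hl hw₀ h0
  set Q₀ := S.erase y₀ with hQ₀
  have hwc : w ∈ coloops M (S \ coloops M G) := by rw [hc]; exact Finset.mem_singleton_self _
  -- `y₀` is not the coloop `w` and not in `K`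
  have hy₀w : y₀ ≠ w := by
    intro h
    exact h0 (by rw [hQ₀, h]; exact faceLossP_eq_zero_of_mem_coloops hG hd hk hs hl hSG hwc (h ▸ hw₀))
  have hy₀K : y₀ ∉ coloops M G := by
    intro hK
    obtain ⟨hthin, -, -, -⟩ := faceLossP_structure h0
    have := coloops_subset_of_mem_thinMembers hG hd' hthin hK
    exact (Finset.notMem_erase y₀ S) ((Finset.erase_subset _ _) this)
  have hy₀V : y₀ ∈ S \ coloops M G := Finset.mem_sdiff.2 ⟨hy₀, hy₀K⟩
  set V := S \ coloops M G with hV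
  have hVg : V ⊆ gr M := Finset.sdiff_subset.trans (hSG.trans hGg)
  have hV5 : rkN M V = 5 := by
    have ha : rkN M (Q₀ \ coloops M G) ≤ rkN M V :=
      rkN_mono (Finset.sdiff_subset_sdiff (Finset.erase_subset _ _) (Finset.Subset.refl _))
    have hb : rkN M V ≤ rkN M (G \ coloops M G) := rkN_mono (Finset.sdiff_subset_sdiff hSG (Finset.Subset.refl _))
    rw [rkN_sdiff_coloops_eq_five hG hk] at hb
    omega
  have hQ₀V : Q₀ \ coloops M G = V.erase y₀ := by
    ext a; simp only [Finset.mem_sdiff, Finset.mem_erase, hV, hQ₀]; tauto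
  rw [hQ₀V] at hQ5 hC3 hImg
  have hcard1 : (coloops M G).card = 1 := by rw [← kColoops_eq_card_coloops (M := M) G]; exact hk
  obtain ⟨e₀, he₀⟩ := Finset.card_eq_one.1 hcard1
  have he₀c : e₀ ∈ coloops M G := by rw [he₀]; exact Finset.mem_singleton_self _
  -- membership: `y₀ ∈ G ∖ Q₀` and the face closures containing `y₀` are only the one at `w`
  refine mem_goodPts.2 ⟨Finset.mem_sdiff.2 ⟨hSG hy₀, Finset.notMem_erase y₀ S⟩, ?_⟩
  rw [hImg]
  have hsub : ((coloops M (V.erase y₀)).image (fun u => Q₀.erase u)).filter (fun F => y₀ ∈ clF M F) ⊆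
      {Q₀.erase w} := by
    intro F hF
    rw [Finset.mem_filter, Finset.mem_image] at hF
    obtain ⟨⟨u, hu, rfl⟩, hyu⟩ := hF
    rw [Finset.mem_singleton]
    by_contra hne
    have huw : u ≠ w := fun h => hne (by rw [h])
    have huV : u ∉ coloops M V := by
      rw [hc, Finset.mem_singleton]; exact huw
    -- `K ⊆ Q₀ ∖ u` (the face is a thin member)
    have hthin : Q₀.erase u ∈ thinMembers M 5 G := by
      have : Q₀.erase u ∈ thinFacesOf M 5 G Q₀ := by
        rw [hImg, Finset.mem_image]; exact ⟨u, hu, rfl⟩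
      unfold thinFacesOf at this
      rw [Finset.mem_filter, mem_coverPreimages] at this
      exact mem_thinMembers.2 ⟨this.1.1, this.2⟩
    have hKQ : coloops M G ⊆ Q₀.erase u := coloops_subset_of_mem_thinMembers hG hd' hthin
    have he₀Q : e₀ ∈ Q₀.erase u := hKQ he₀c
    have hface : Q₀.erase u = insert e₀ ((V.erase y₀).erase u) := by
      ext a
      simp only [Finset.mem_erase, Finset.mem_insert, Finset.mem_sdiff, hV, hQ₀, he₀, Finset.mem_singleton]
      constructor
      · rintro ⟨hau, hay, haS⟩
        by_cases hae : a = e₀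
        · exact Or.inl hae
        · exact Or.inr ⟨hau, hay, haS, hae⟩
      · rintro (rfl | ⟨hau, hay, haS, -⟩)
        · have h1 := Finset.mem_erase.1 he₀Q
          have h2 := Finset.mem_erase.1 h1.2
          exact ⟨h1.1, h2.1, h2.2⟩
        · exact ⟨hau, hay, haS⟩
    rw [hface] at hyu
    have hyu' : y₀ ∈ clF M ((V.erase y₀).erase u) :=
      mem_clF_sdiff_coloops_of_mem_clF_insert hG he₀ (((Finset.erase_subset _ _).trans
        (Finset.erase_subset _ _)).trans (Finset.sdiff_subset_sdiff hSG (Finset.Subset.refl _)))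
        (Finset.mem_sdiff.2 ⟨hSG hy₀, hy₀K⟩) hyu
    exact notMem_clF_face_of_not_coloop hVg hV5 hy₀V hQ5 hu huV hyu'
  exact (Finset.card_le_card hsub).trans (by rw [Finset.card_singleton])

end CaseOneGeom

end PercRepro.Shadow
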